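import Literature.NumberTheory.LFunctions.Zhang2022.RepairSection18Forms
import Literature.NumberTheory.LFunctions.Zhang2022.RepairBoxPrimitives

/-!
# Zhang (2022) §18-margin repair rung: INTERVAL-INPUT boxes of the θ-generic §18 slice
# (`eR`, `vkR`, `I₆, I₇`, `g₃, g₄`, `F₂₀, F₂₁, F₃₀, F₃₁`) — the entry layer a kernel leaf needs
# off the printed point

Trunk T-ANT (NumberTheory/LFunctions). Y. Zhang, *Discrete mean estimates and the Landau–Siegel
zero*, arXiv:2211.02515v1 (2022) [Zhang2022LandauSiegel] — **an unrefereed manuscript under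
adjudication; nothing here asserts or denies its Theorems 1–2 or any analytic lemma; no claim about
Landau–Siegel zeros is made.** Rung F-S1R (D-0077), LOCAL ANNEX K-N (ASSIGNMENTS v2: "K1 ONE certified
tie segment around θ₀"), seat repair-p6 (CLAIM K-N-boxes18).

The barrier annex certifies floors of the §18 total over a BOX of structural parameters by the
per-leaf test `cmatEncl ∧ hermPsdCheck` (`RepairCoverFrame.psdLeafOK`) on the box table
`RepairFormMatrix.QBoxOf (c₁₁ c₂₁ c₁₂ c₂₂ c₃₃ c₃₄ F₂₀ F₂₁ F₃₀ F₃₁)`. The `§8/§9` pair-block entries over an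
interval of lengths are `RepairSection9Boxes.cDiagBL/cCrossBL` (p5). This file supplies the remaining
four entries — p1's θ-generic (18.1) coefficients `Repair.F20T … F31T` (`RepairSection18Forms`), built
from the Lemma 15.1 / App. B closed form `Repair.eR ν k j`, the unit values `Repair.vkR ν k` and the
§12 coefficients `Repair.g3T/g4T` (`I6T/I7T`) — as complex boxes whose length inputs are FIXED-POINT
INTERVALS (`FI`) and whose shifts `k` are rational, through p5's interval primitives
(`RepairBoxPrimitives`: `recipMulPiFI`, `recipFI`, `scaleRatFI`, `expIpiFI` with validity flags):

* `eRB k j V ∋ eR ν k j` for every `ν ∈ V` (`mem_eRB`; the algebra `eR = (1 − j/k − c·i)e^{νkπi} + c·i`,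
  `c = (j/k²)/(νπ)`, `eR_eq_box_shape`), `vkRB k V ∋ vkR ν k` (`mem_vkRB`);
* `L6FI/L7FI`, `I6B/I7B`, `g3B/g4B` (`mem_…`) for `ν_μ ∈ V_μ`;
* **`F20TB/F21TB/F30TB/F31TB (k₁ k₂ k₃ : ℚ) (V₁ V₂ V₃ : FI)`** with `mem_F20TB` …: for every `θ` with
  `θ.nu_μ ∈ V_μ` and `θ.k_μ = k_μ`, `F··T θ ∈ F··TB …`; validity flag `slice18OK`;
* regression at the printed point: with point intervals the boxes contain the tree's `F20, F21, F30,
  F31` (`F20_mem_F20TB` …, via p1's `F20T_thetaIota`).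

Pure box bookkeeping over p5's primitives (inclusion property of interval arithmetic); no analytic
content, no new `Prop` facts, nothing about Theorems 1–2.

## References

* Y. Zhang, arXiv:2211.02515v1 (2022), (8.6), §12 (12.13)–(12.15), Lemma 15.1, (17.4), §18 (18.1),
  Appendix B. [cite: Zhang2022LandauSiegel, §§8, 12, 15, 17, 18, App. B]
* R. E. Moore, *Interval Analysis*, Prentice-Hall (1966), Theorem 3.1. [Moore1966]
-/

noncomputable section

open Complex Real ComplexConjugate
open Literature.Analysis.ValidatedNumerics.Numerics

namespace Literature.NumberTheory.LFunctions.Zhang2022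

namespace Repair

attribute [local irreducible] CB.add CB.sub CB.mul CB.neg CB.conj CB.mulFI CB.mulI CB.mulInt
  CB.ofFI CB.ofInt CB.normSqFI CB.expI FI.add FI.sub FI.mul FI.neg FI.mulInt FI.divNat FI.divPos
  FI.ofRat FI.ofInt FI.pi qCB piMul expIpi overPiFI piISq mulPiFI scaleRatFI recipFI
  recipMulPiFI expIpiFI

/-! ### `eR ν k j` and `vkR ν k` over an interval of lengths -/

/-- the real scalar `c(ν, k, j) = (j/k²)·(1/(νπ))` of the closed form `eR`, as an interval for `ν ∈ V`.
[cite: Zhang2022LandauSiegel, Lemma 15.1, Appendix B] -/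
def eCoefFI (k : ℚ) (j : ℕ) (V : FI) : FI := scaleRatFI (recipMulPiFI V) ((j : ℚ) / k ^ 2)

/-- `c(ν, k, j) ∈ eCoefFI k j V`. [cite: Moore1966, Theorem 3.1] -/
theorem mem_eCoefFI {ν : ℝ} {V : FI} (hV : FI.mem ν V) (hR : recipMulPiOK V = true) (k : ℚ) (j : ℕ) :
    FI.mem (((((j : ℚ) / k ^ 2 : ℚ)) : ℝ) * invMulPi ν) (eCoefFI k j V) := by
  unfold eCoefFI; exact mem_scaleRatFI (mem_recipMulPiFI hR hV) _

/-- **box of `eR ν k j`** for `ν ∈ V`: `((1 − j/k) − c·i)·e^{νkπi} + c·i`. [cite: Zhang2022LandauSiegel, Lemma 15.1, Appendix B] -/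
@[irreducible] def eRB (k : ℚ) (j : ℕ) (V : FI) : CB :=
  (((qCB (1 - (j : ℚ) / k)).sub ((CB.ofFI (eCoefFI k j V)).mulI)).mul (expIpiFI (scaleRatFI V k))).add
    ((CB.ofFI (eCoefFI k j V)).mulI)

/-- validity flag of `eRB`/`vkRB` on `V` (reciprocal of `νπ` and `e^{νkπi}` evaluable). [folklore] -/
def eROK (k : ℚ) (V : FI) : Bool := recipMulPiOK V && expIpiFIOK (scaleRatFI V k)

/-- the closed form in box shape: `eR ν k j = ((1 − j/k) − c·i)e^{νkπi} + c·i`, `c = (j/k²)/(νπ)`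
(`1/(k²νπi) = −i·c`). [cite: Zhang2022LandauSiegel, Lemma 15.1, Appendix B] -/
theorem eR_eq_box_shape {ν : ℝ} (hν : ν ≠ 0) {k : ℚ} (hk : k ≠ 0) (j : ℕ) :
    eR ν k j = ((((1 - (j : ℚ) / k : ℚ)) : ℂ) - (((((j : ℚ) / k ^ 2 : ℚ)) : ℝ) * invMulPi ν : ℝ) * I)
        * cexp (((((k : ℝ) * ν * π : ℝ)) : ℂ) * I)
      + (((((j : ℚ) / k ^ 2 : ℚ)) : ℝ) * invMulPi ν : ℝ) * I := by
  have hk' : ((k : ℝ) : ℂ) ≠ 0 := by exact_mod_cast (show (k : ℝ) ≠ 0 by exact_mod_cast hk)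
  have hν' : (ν : ℂ) ≠ 0 := by exact_mod_cast hν
  have hπ : (π : ℂ) ≠ 0 := by exact_mod_cast Real.pi_ne_zero
  have hden : ((k : ℝ) : ℂ) ^ 2 * ν * π * I ≠ 0 :=
    mul_ne_zero (mul_ne_zero (mul_ne_zero (pow_ne_zero 2 hk') hν') hπ) I_ne_zero
  have hdiv : (j : ℂ) / (((k : ℝ) : ℂ) ^ 2 * ν * π * I)
      = -((((((j : ℚ) / k ^ 2 : ℚ)) : ℝ) * invMulPi ν : ℝ) : ℂ) * I := by
    rw [div_eq_iff hden]
    unfold invMulPi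
    push_cast
    field_simp
    rw [show I ^ 2 = -1 from I_sq]
    ring
  have hexp : cexp ((ν : ℂ) * ((k : ℝ) : ℂ) * π * I) = cexp (((((k : ℝ) * ν * π : ℝ)) : ℂ) * I) := by
    congr 1; push_cast; ring
  unfold eR
  rw [hexp, hdiv]
  push_cast
  ring

/-- **`eR ν k j ∈ eRB k j V`** for `ν ∈ V`, `ν ≠ 0`, `k ≠ 0`, flag set. [cite: Moore1966, Theorem 3.1] -/
theorem mem_eRB {ν : ℝ} {V : FI} (hV : FI.mem ν V) (hν : ν ≠ 0) {k : ℚ} (hk : k ≠ 0)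
    (hOK : eROK k V = true) (j : ℕ) : CB.mem (eR ν k j) (eRB k j V) := by
  unfold eROK at hOK
  rw [Bool.and_eq_true] at hOK
  have hc := CB.mem_ofFI (mem_eCoefFI hV hOK.1 k j)
  have hE := mem_expIpiFI hOK.2 (mem_scaleRatFI hV k)
  rw [eR_eq_box_shape hν hk j]
  unfold eRB
  exact CB.mem_add (CB.mem_mul (CB.mem_sub (mem_qCB _) (CB.mem_mulI hc)) hE) (CB.mem_mulI hc)

/-- **box of `vkR ν k = e^{νkπi}`** for `ν ∈ V`. [cite: Zhang2022LandauSiegel, (8.6), (17.4)] -/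
@[irreducible] def vkRB (k : ℚ) (V : FI) : CB := expIpiFI (scaleRatFI V k)

/-- `vkR ν k ∈ vkRB k V`. [cite: Moore1966, Theorem 3.1] -/
theorem mem_vkRB {ν : ℝ} {V : FI} (hV : FI.mem ν V) (k : ℚ) (hOK : eROK k V = true) :
    CB.mem (vkR ν k) (vkRB k V) := by
  unfold eROK at hOK
  rw [Bool.and_eq_true] at hOK
  have hexp : vkR ν k = cexp (((((k : ℝ) * ν * π : ℝ)) : ℂ) * I) := by
    unfold vkR; congr 1; push_cast; ring
  rw [hexp]; unfold vkRB
  exact mem_expIpiFI hOK.2 (mem_scaleRatFI hV k)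

/-! ### `I₆, I₇`, `g₃, g₄` over intervals -/

/-- interval of `L₆ = ν₁ + ν₃ − 1` resp. `L₇ = ν₁ + ν₂ − 1`. [cite: Zhang2022LandauSiegel, §12 (12.13)] -/
def LFI (V1 V : FI) : FI := (V1.add V).sub (FI.ofInt 1)

/-- `ν₁ + ν − 1 ∈ LFI V₁ V`. [cite: Moore1966, Theorem 3.1] -/
theorem mem_LFI {ν1 ν : ℝ} {V1 V : FI} (h1 : FI.mem ν1 V1) (h : FI.mem ν V) :
    FI.mem (ν1 + ν - 1) (LFI V1 V) := by
  unfold LFI; simpa using FI.mem_sub (FI.mem_add h1 h) (FI.mem_ofInt 1)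

/-- **box of `I(L, s) = −L − πiL²s`** for `L ∈ LI`, rational `s` (Zhang's linearised (12.13) values:
`I₆ = I(L₆, k₁+k₃−3)`, `I₇ = I(L₇, k₁+k₂−3)`). [cite: Zhang2022LandauSiegel, §12 (12.13)–(12.14)] -/
@[irreducible] def IB6 (LI : FI) (s : ℚ) : CB :=
  (CB.ofFI LI).neg.sub ((((CB.ofFI FI.pi).mulI).mul (CB.ofFI (LI.mul LI))).mul (qCB s))

/-- `−L − πiL²s ∈ IB6 LI s`. [cite: Moore1966, Theorem 3.1] -/
theorem mem_IB6 {L : ℝ} {LI : FI} (hL : FI.mem L LI) (s : ℚ) :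
    CB.mem (-(L : ℂ) - π * I * (L : ℂ) ^ 2 * ((s : ℚ) : ℂ)) (IB6 LI s) := by
  have e : -(L : ℂ) - π * I * (L : ℂ) ^ 2 * ((s : ℚ) : ℂ)
      = -(L : ℂ) - ((π : ℂ) * I) * (((L * L : ℝ)) : ℂ) * ((s : ℚ) : ℂ) := by push_cast; ring
  rw [e]; unfold IB6
  exact CB.mem_sub (CB.mem_neg (CB.mem_ofFI hL))
    (CB.mem_mul (CB.mem_mul (CB.mem_mulI mem_piCB) (CB.mem_ofFI (FI.mem_mul hL hL))) (mem_qCB s))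

/-- `I₆(θ) ∈ IB6 (LFI V₁ V₃) (k₁ + k₃ − 3)`. [cite: Zhang2022LandauSiegel, §12 (12.13)–(12.14)] -/
theorem mem_I6T {θ : Theta} {V1 V3 : FI} {k1 k3 : ℚ} (h1 : FI.mem θ.nu1 V1) (h3 : FI.mem θ.nu3 V3)
    (hk1 : θ.k1 = k1) (hk3 : θ.k3 = k3) : CB.mem (I6T θ) (IB6 (LFI V1 V3) (k1 + k3 - 3)) := by
  have h := mem_IB6 (mem_LFI h1 h3) (k1 + k3 - 3)
  have e : I6T θ = -((θ.nu1 + θ.nu3 - 1 : ℝ) : ℂ) - π * I * ((θ.nu1 + θ.nu3 - 1 : ℝ) : ℂ) ^ 2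
      * (((k1 + k3 - 3 : ℚ)) : ℂ) := by
    unfold I6T Theta.L6; rw [hk1, hk3]; push_cast; ring
  rw [e]; exact h

/-- `I₇(θ) ∈ IB6 (LFI V₁ V₂) (k₁ + k₂ − 3)`. [cite: Zhang2022LandauSiegel, §12 (12.13)–(12.14)] -/
theorem mem_I7T {θ : Theta} {V1 V2 : FI} {k1 k2 : ℚ} (h1 : FI.mem θ.nu1 V1) (h2 : FI.mem θ.nu2 V2)
    (hk1 : θ.k1 = k1) (hk2 : θ.k2 = k2) : CB.mem (I7T θ) (IB6 (LFI V1 V2) (k1 + k2 - 3)) := by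
  have h := mem_IB6 (mem_LFI h1 h2) (k1 + k2 - 3)
  have e : I7T θ = -((θ.nu1 + θ.nu2 - 1 : ℝ) : ℂ) - π * I * ((θ.nu1 + θ.nu2 - 1 : ℝ) : ℂ) ^ 2
      * (((k1 + k2 - 3 : ℚ)) : ℂ) := by
    unfold I7T Theta.L7; rw [hk1, hk2]; push_cast; ring
  rw [e]; exact h

/-- **box of `g(ν₁, I, ν) = (4/(ν₁π))·I/ν`** from boxes of the pieces (`g₃ = g(ν₁, I₆, ν₃)`,
`g₄ = g(ν₁, I₇, ν₂)`). [cite: Zhang2022LandauSiegel, §12 (12.14)–(12.15)] -/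
@[irreducible] def gB (V1 : FI) (IBx : CB) (V : FI) : CB :=
  ((CB.ofFI (scaleRatFI (recipMulPiFI V1) 4)).mul IBx).mulFI (recipFI V)

/-- validity flag of `gB` (reciprocals of `ν₁π` and `ν`). [folklore] -/
def gOK (V1 V : FI) : Bool := recipMulPiOK V1 && recipOK V

/-- `(4/(ν₁π))·z/ν ∈ gB V₁ B V` for `ν₁ ∈ V₁`, `z ∈ B`, `ν ∈ V`. [cite: Moore1966, Theorem 3.1] -/
theorem mem_gB {ν1 ν : ℝ} {z : ℂ} {V1 V : FI} {B : CB} (h1 : FI.mem ν1 V1) (hz : CB.mem z B)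
    (hν : FI.mem ν V) (hOK : gOK V1 V = true) :
    CB.mem (((4 / (ν1 * π) : ℝ) : ℂ) * z / (ν : ℂ)) (gB V1 B V) := by
  unfold gOK at hOK
  rw [Bool.and_eq_true] at hOK
  have h4 := mem_scaleRatFI (mem_recipMulPiFI hOK.1 h1) 4
  have hr := mem_recipFI hOK.2 hν
  have e : ((4 / (ν1 * π) : ℝ) : ℂ) * z / (ν : ℂ)
      = (((((4 : ℚ) : ℝ) * invMulPi ν1 : ℝ) : ℂ) * z) * (((1 / ν : ℝ)) : ℂ) := by
    unfold invMulPi; push_cast; ring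
  rw [e]; unfold gB
  exact CB.mem_mulFI (CB.mem_mul (CB.mem_ofFI h4) hz) hr

/-- `g₃(θ) ∈ gB V₁ (IB6 (LFI V₁ V₃) (k₁+k₃−3)) V₃`. [cite: Zhang2022LandauSiegel, §12 (12.14)–(12.15)] -/
theorem mem_g3T {θ : Theta} {V1 V3 : FI} {k1 k3 : ℚ} (h1 : FI.mem θ.nu1 V1) (h3 : FI.mem θ.nu3 V3)
    (hk1 : θ.k1 = k1) (hk3 : θ.k3 = k3) (hOK : gOK V1 V3 = true) :
    CB.mem (g3T θ) (gB V1 (IB6 (LFI V1 V3) (k1 + k3 - 3)) V3) := by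
  unfold g3T; exact mem_gB h1 (mem_I6T h1 h3 hk1 hk3) h3 hOK

/-- `g₄(θ) ∈ gB V₁ (IB6 (LFI V₁ V₂) (k₁+k₂−3)) V₂`. [cite: Zhang2022LandauSiegel, §12 (12.14)–(12.15)] -/
theorem mem_g4T {θ : Theta} {V1 V2 : FI} {k1 k2 : ℚ} (h1 : FI.mem θ.nu1 V1) (h2 : FI.mem θ.nu2 V2)
    (hk1 : θ.k1 = k1) (hk2 : θ.k2 = k2) (hOK : gOK V1 V2 = true) :
    CB.mem (g4T θ) (gB V1 (IB6 (LFI V1 V2) (k1 + k2 - 3)) V2) := by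
  unfold g4T; exact mem_gB h1 (mem_I7T h1 h2 hk1 hk2) h2 hOK

/-! ### The (18.1) coefficients `F₂₀, F₂₁, F₃₀, F₃₁` over intervals -/

/-- box of `−i(3a₁b₁ + 3a₂b₂ + a₃b₃ + v)` from boxes of the pieces. [cite: Zhang2022LandauSiegel, §18 (18.1)] -/
def triB (a b : ℕ → CB) (v : CB) : CB :=
  IB.neg.mul (((((CB.ofInt 3).mul ((a 1).mul (b 1))).add ((CB.ofInt 3).mul ((a 2).mul (b 2)))).add
    ((a 3).mul (b 3))).add v)

/-- soundness of `triB`. [cite: Moore1966, Theorem 3.1] -/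
theorem mem_triB {f g : ℕ → ℂ} {w : ℂ} {a b : ℕ → CB} {v : CB} (hf : ∀ j, CB.mem (f j) (a j))
    (hg : ∀ j, CB.mem (g j) (b j)) (hw : CB.mem w v) :
    CB.mem (-I * (3 * (f 1 * g 1) + 3 * (f 2 * g 2) + f 3 * g 3 + w)) (triB a b v) := by
  unfold triB
  exact CB.mem_mul mem_negIB (CB.mem_add (CB.mem_add (CB.mem_add
    (CB.mem_mul mem_threeCB (CB.mem_mul (hf 1) (hg 1)))
    (CB.mem_mul mem_threeCB (CB.mem_mul (hf 2) (hg 2)))) (CB.mem_mul (hf 3) (hg 3))) hw)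

/-- **box of `F₂₀(θ)`** for `θ.nu_μ ∈ V_μ`, `θ.k_μ = k_μ`. [cite: Zhang2022LandauSiegel, §18 (18.1)] -/
@[irreducible] def F20TB (k1 k3 : ℚ) (V1 V3 : FI) : CB :=
  (triB (fun j => eRB k1 j V1) (fun j => eRB k3 j V3) ((vkRB k1 V1).mul (vkRB k3 V3))).add
    ((CB.ofInt 2).mul (gB V1 (IB6 (LFI V1 V3) (k1 + k3 - 3)) V3))
/-- **box of `F₂₁(θ)`**. [cite: Zhang2022LandauSiegel, §18 (18.1)] -/
@[irreducible] def F21TB (k2 k3 : ℚ) (V2 V3 : FI) : CB :=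
  triB (fun j => eRB k2 j V2) (fun j => eRB k3 j V3) ((vkRB k2 V2).mul (vkRB k3 V3))
/-- **box of `F₃₀(θ)`** (`𝔳𝔨₄ := 𝔳𝔨₂`). [cite: Zhang2022LandauSiegel, §18 (18.1), (17.4)] -/
@[irreducible] def F30TB (k1 k2 : ℚ) (V1 V2 : FI) : CB :=
  (triB (fun j => eRB k1 j V1) (fun j => eRB k2 j V2) ((vkRB k1 V1).mul (vkRB k2 V2))).add
    ((CB.ofInt 2).mul (gB V1 (IB6 (LFI V1 V2) (k1 + k2 - 3)) V2))
/-- **box of `F₃₁(θ)`**. [cite: Zhang2022LandauSiegel, §18 (18.1)] -/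
@[irreducible] def F31TB (k2 : ℚ) (V2 : FI) : CB :=
  triB (fun j => eRB k2 j V2) (fun j => eRB k2 j V2) ((vkRB k2 V2).mul (vkRB k2 V2))

/-- validity flag for the four `F··TB` boxes on `(V₁, V₂, V₃)`. [folklore] -/
def slice18OK (k1 k2 k3 : ℚ) (V1 V2 V3 : FI) : Bool :=
  eROK k1 V1 && eROK k2 V2 && eROK k3 V3 && gOK V1 V3 && gOK V1 V2

/-- The hypotheses of a slice box evaluation at `θ`: lengths in the intervals and non-zero, shifts equal
to the rational box shifts and non-zero, flags set. [cite: Moore1966, Theorem 3.1] -/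
structure SliceHyp (θ : Theta) (k1 k2 k3 : ℚ) (V1 V2 V3 : FI) : Prop where
  h1 : FI.mem θ.nu1 V1
  h2 : FI.mem θ.nu2 V2
  h3 : FI.mem θ.nu3 V3
  n1 : θ.nu1 ≠ 0
  n2 : θ.nu2 ≠ 0
  n3 : θ.nu3 ≠ 0
  hk1 : θ.k1 = k1
  hk2 : θ.k2 = k2
  hk3 : θ.k3 = k3
  k1ne : k1 ≠ 0
  k2ne : k2 ≠ 0
  k3ne : k3 ≠ 0
  ok : slice18OK k1 k2 k3 V1 V2 V3 = true

variable {θ : Theta} {k1 k2 k3 : ℚ} {V1 V2 V3 : FI}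

/-- unpacking the flag. [cite: Moore1966, Theorem 3.1] -/
theorem SliceHyp.oks (H : SliceHyp θ k1 k2 k3 V1 V2 V3) :
    eROK k1 V1 = true ∧ eROK k2 V2 = true ∧ eROK k3 V3 = true ∧ gOK V1 V3 = true ∧ gOK V1 V2 = true := by
  have h := H.ok
  unfold slice18OK at h
  simp only [Bool.and_eq_true] at h
  exact ⟨h.1.1.1.1, h.1.1.1.2, h.1.1.2, h.1.2, h.2⟩

/-- `e′_{1j}(θ) ∈ eRB k₁ j V₁`. [cite: Zhang2022LandauSiegel, Lemma 15.1] -/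
theorem SliceHyp.mem_e1pT (H : SliceHyp θ k1 k2 k3 V1 V2 V3) (j : ℕ) : CB.mem (e1pT θ j) (eRB k1 j V1) := by
  unfold e1pT; rw [H.hk1]; exact mem_eRB H.h1 H.n1 H.k1ne H.oks.1 j
/-- `e_{2j}(θ) ∈ eRB k₂ j V₂`. [cite: Zhang2022LandauSiegel, Lemma 15.1] -/
theorem SliceHyp.mem_e2T (H : SliceHyp θ k1 k2 k3 V1 V2 V3) (j : ℕ) : CB.mem (e2T θ j) (eRB k2 j V2) := by
  unfold e2T; rw [H.hk2]; exact mem_eRB H.h2 H.n2 H.k2ne H.oks.2.1 j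
/-- `e_{3j}(θ) ∈ eRB k₃ j V₃`. [cite: Zhang2022LandauSiegel, Lemma 15.1] -/
theorem SliceHyp.mem_e3T (H : SliceHyp θ k1 k2 k3 V1 V2 V3) (j : ℕ) : CB.mem (e3T θ j) (eRB k3 j V3) := by
  unfold e3T; rw [H.hk3]; exact mem_eRB H.h3 H.n3 H.k3ne H.oks.2.2.1 j
/-- `𝔳𝔨₁(θ) ∈ vkRB k₁ V₁`. [cite: Zhang2022LandauSiegel, (17.4)] -/
theorem SliceHyp.mem_vk1T (H : SliceHyp θ k1 k2 k3 V1 V2 V3) : CB.mem (vk1T θ) (vkRB k1 V1) := by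
  unfold vk1T; rw [H.hk1]; exact mem_vkRB H.h1 k1 H.oks.1
/-- `𝔳𝔨₂(θ) ∈ vkRB k₂ V₂`. [cite: Zhang2022LandauSiegel, (17.4)] -/
theorem SliceHyp.mem_vk2T (H : SliceHyp θ k1 k2 k3 V1 V2 V3) : CB.mem (vk2T θ) (vkRB k2 V2) := by
  unfold vk2T; rw [H.hk2]; exact mem_vkRB H.h2 k2 H.oks.2.1
/-- `𝔳𝔨₃(θ) ∈ vkRB k₃ V₃`. [cite: Zhang2022LandauSiegel, (17.4)] -/
theorem SliceHyp.mem_vk3T (H : SliceHyp θ k1 k2 k3 V1 V2 V3) : CB.mem (vk3T θ) (vkRB k3 V3) := by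
  unfold vk3T; rw [H.hk3]; exact mem_vkRB H.h3 k3 H.oks.2.2.1
/-- `𝔳𝔨₄(θ) = 𝔳𝔨₂(θ) ∈ vkRB k₂ V₂`. [cite: Zhang2022LandauSiegel, (17.4), (2.27)] -/
theorem SliceHyp.mem_vk4T (H : SliceHyp θ k1 k2 k3 V1 V2 V3) : CB.mem (vk4T θ) (vkRB k2 V2) := by
  unfold vk4T; exact H.mem_vk2T

/-- **`F₂₀(θ) ∈ F20TB k₁ k₃ V₁ V₃`**. [cite: Zhang2022LandauSiegel, §18 (18.1)] -/
theorem SliceHyp.mem_F20T (H : SliceHyp θ k1 k2 k3 V1 V2 V3) : CB.mem (F20T θ) (F20TB k1 k3 V1 V3) := by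
  unfold F20T F20TB
  exact CB.mem_add (mem_triB H.mem_e1pT H.mem_e3T (CB.mem_mul H.mem_vk1T H.mem_vk3T))
    (CB.mem_mul mem_twoCB (mem_g3T H.h1 H.h3 H.hk1 H.hk3 H.oks.2.2.2.1))
/-- **`F₂₁(θ) ∈ F21TB k₂ k₃ V₂ V₃`**. [cite: Zhang2022LandauSiegel, §18 (18.1)] -/
theorem SliceHyp.mem_F21T (H : SliceHyp θ k1 k2 k3 V1 V2 V3) : CB.mem (F21T θ) (F21TB k2 k3 V2 V3) := by
  unfold F21T F21TB
  exact mem_triB H.mem_e2T H.mem_e3T (CB.mem_mul H.mem_vk2T H.mem_vk3T)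
/-- **`F₃₀(θ) ∈ F30TB k₁ k₂ V₁ V₂`**. [cite: Zhang2022LandauSiegel, §18 (18.1)] -/
theorem SliceHyp.mem_F30T (H : SliceHyp θ k1 k2 k3 V1 V2 V3) : CB.mem (F30T θ) (F30TB k1 k2 V1 V2) := by
  unfold F30T F30TB
  exact CB.mem_add (mem_triB H.mem_e1pT H.mem_e2T (CB.mem_mul H.mem_vk1T H.mem_vk4T))
    (CB.mem_mul mem_twoCB (mem_g4T H.h1 H.h2 H.hk1 H.hk2 H.oks.2.2.2.2))
/-- **`F₃₁(θ) ∈ F31TB k₂ V₂`**. [cite: Zhang2022LandauSiegel, §18 (18.1)] -/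
theorem SliceHyp.mem_F31T (H : SliceHyp θ k1 k2 k3 V1 V2 V3) : CB.mem (F31T θ) (F31TB k2 V2) := by
  unfold F31T F31TB
  exact mem_triB H.mem_e2T H.mem_e2T (CB.mem_mul H.mem_vk2T H.mem_vk4T)

/-! ### Regression at the printed point: point intervals reproduce the tree's `F₂₀, F₂₁, F₃₀, F₃₁` -/

/-- the printed lengths as point intervals. [cite: Zhang2022LandauSiegel, (2.21)–(2.22)] -/
def V1printed : FI := FI.ofRat (63/125)
/-- [cite: Zhang2022LandauSiegel, (2.21)–(2.22)] -/
def V2printed : FI := FI.ofRat (1/2)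
/-- [cite: Zhang2022LandauSiegel, (2.21)–(2.22)] -/
def V3printed : FI := FI.ofRat (249/500)

/-- the printed `ι`-family satisfies the slice hypotheses for the point intervals. [cite: Zhang2022LandauSiegel, (2.21)–(2.26)] -/
theorem sliceHyp_thetaIota (w2 w3 w4 : ℂ) :
    SliceHyp (thetaIota w2 w3 w4) (3/2) (5/2) (3/2) V1printed V2printed V3printed where
  h1 := by rw [thetaIota_nu1]; unfold V1printed; convert FI.mem_ofRat (63/125 : ℚ) using 1; norm_num
  h2 := by rw [thetaIota_nu2]; unfold V2printed; convert FI.mem_ofRat (1/2 : ℚ) using 1; norm_num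
  h3 := by rw [thetaIota_nu3]; unfold V3printed; convert FI.mem_ofRat (249/500 : ℚ) using 1; norm_num
  n1 := by rw [thetaIota_nu1]; norm_num
  n2 := by rw [thetaIota_nu2]; norm_num
  n3 := by rw [thetaIota_nu3]; norm_num
  hk1 := by rw [thetaIota_k1]; norm_num
  hk2 := by rw [thetaIota_k2]; norm_num
  hk3 := by rw [thetaIota_k3]; norm_num
  k1ne := by norm_num
  k2ne := by norm_num
  k3ne := by norm_num
  ok := by decide +kernel

/-- **regression**: the tree's `F₂₀` lies in the point-interval box `F20TB (3/2) (3/2) V₁ V₃`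
(via p1's `F20T_thetaIota`). [cite: Zhang2022LandauSiegel, §18 (18.1)] -/
theorem F20_mem_F20TB : CB.mem F20 (F20TB (3/2) (3/2) V1printed V3printed) := by
  rw [← F20T_thetaIota 0 0 0]; exact (sliceHyp_thetaIota 0 0 0).mem_F20T
/-- the tree's `F₂₁` lies in `F21TB (5/2) (3/2) V₂ V₃`. [cite: Zhang2022LandauSiegel, §18 (18.1)] -/
theorem F21_mem_F21TB : CB.mem F21 (F21TB (5/2) (3/2) V2printed V3printed) := by
  rw [← F21T_thetaIota 0 0 0]; exact (sliceHyp_thetaIota 0 0 0).mem_F21T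
/-- the tree's `F₃₀` lies in `F30TB (3/2) (5/2) V₁ V₂`. [cite: Zhang2022LandauSiegel, §18 (18.1)] -/
theorem F30_mem_F30TB : CB.mem F30 (F30TB (3/2) (5/2) V1printed V2printed) := by
  rw [← F30T_thetaIota 0 0 0]; exact (sliceHyp_thetaIota 0 0 0).mem_F30T
/-- the tree's `F₃₁` lies in `F31TB (5/2) V₂`. [cite: Zhang2022LandauSiegel, §18 (18.1)] -/
theorem F31_mem_F31TB : CB.mem F31 (F31TB (5/2) V2printed) := by
  rw [← F31T_thetaIota 0 0 0]; exact (sliceHyp_thetaIota 0 0 0).mem_F31T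

end Repair

end Literature.NumberTheory.LFunctions.Zhang2022
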